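import Mathlib.Analysis.Complex.Harmonic.Poisson
import Mathlib.Analysis.SpecialFunctions.PolarCoord
import Literature.Analysis.FluidPDE.AxisymBiotSavartSupBound
import Literature.Analysis.FluidPDE.CylindricalIntegration
import HarnessLib

/-!
# The axisymmetric Biot–Savart sup bound with the constant `1/(2√2)`:
# `‖u‖_∞ ≤ (2√2)⁻¹ (‖ω_θ/r‖_{L^∞} ∫_{ℝ³}‖ω‖)^{1/2}`
# (Feng–Šverák 2015 / Gallay–Šverák 2015, Prop. 2.6 (2.14), sharpened constant — proved)

Analysis/FluidPDE proof file (theorems only; no definitions, no named facts). It SHARPENS the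
constant of the tree's `norm_biotSavart_le_sqrt_of_norm_le_mul_cylRadius`
(`AxisymBiotSavartSupBound.lean`, `C = 3`) to `C = 1/(2√2) = 0.35355…`:

* `norm_biotSavart_le_sqrt_div_eight` — for a continuous integrable vector field `w` on `ℝ³`
  whose norm is invariant under the rotations about the axis (`‖w(R_θ y)‖ = ‖w(y)‖`) and satisfies
  `‖w(y)‖ ≤ M r(y)` (`r = cylRadius`), the Biot–Savart velocity `K₃ ∗ w = biotSavart w`
  (Majda–Bertozzi (2.10)–(2.12), `Vorticity.lean`) obeys, for every `x`,
  `‖(K₃ ∗ w)(x)‖ ≤ √(M ∫_{ℝ³}‖w‖ / 8)`; in the units of the paper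
  (`∫_{ℝ³}‖ω‖ dx = 2π‖rω_θ‖_{L¹(Ω)}`, `M = ‖ω_θ/r‖_{L^∞}`) this is (2.14) with `C = (π/4)^{1/2}`;
  `…_of_isAxisymmetric` (axisymmetric `w`) and the decimal form `norm_biotSavart_le_const_mul_sqrt`
  (`≤ 0.35356 √(M ∫‖w‖)`).

The constant `1/(2√2)` is the EXACT value of the linear-programming (bathtub) bound for the
isotropic majorant `(4π)⁻¹|x − y|⁻²` of the kernel over the class `{|ω| ≤ M r, ∫|ω| = A}` (it is
attained in the limit of thin vortex rings far from the axis; on the axis the same bound gives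
`1/4`), hence within the factor `(2√2)⁻¹ / (√3/8) ≈ 1.63` of the sharp constant `√3/8 = 0.2165…` of
the true kernel (Hill-type extremiser, cell `ns-blowup` memo KJ-13); the tree's `C = 3` method
lost the factor `≈ 14`.

## The proof

1. `‖(K₃ ∗ w)(x)‖ ≤ (4π)⁻¹ ∫ ‖w(y)‖ |x − y|⁻² dy` (`norm_biotSavartKernel_le`, `BiotSavartBounds`).
2. **Exact orbit average** (§1): for `y` off the orbit circle of `x`,
   `∫₀^{2π} |x − R_θ y|⁻² dθ = 2π/(d₁ d₂)`, where `d₁, d₂` are the distances, in the meridian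
   half-plane, from `(r(y), y₂)` to `(r(x), x₂)` and to `(−r(x), x₂)`
   (`integral_inv_norm_sub_rotZ_sq`): with `α = r(x)² + r(y)² + (x₂−y₂)²`, `ρ² = (α + d₁d₂)/2` and
   the pole `w₀ = (x_h·y_h + i x_h×y_h)/ρ` one has `|x − R_θ y|² = |ρe^{iθ} − w₀|²`, so the integrand
   is `(d₁d₂)⁻¹ ×` the Poisson kernel of the disc `|z| < ρ`, whose circle average is `1` (Mathlib's
   Poisson integral formula `HarmonicContOnCl.circleAverage_poissonKernel_smul` for the constant
   `1`). By rotation averaging (Tonelli; §2, the `C = 3` file's private lemma re-proved on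
   `[0, 2π]`) and since the orbit of `x` lies in the null hyperplane `{y₂ = x₂}`,
   `∫ ‖w‖ |x−y|⁻² dy = ∫ ‖w(y)‖ (d₁d₂)⁻¹ dy` (`lintegral_enorm_mul_inv_norm_sq_eq_orbit`,
   `enorm_biotSavart_le_lintegral_orbitKernel`).
3. **Duality** (§5): `‖w‖ (d₁d₂)⁻¹ ≤ t‖w‖ + M r (y) ((d₁d₂)⁻¹ − t)₊` for every `t ≥ 0`
   (`lintegral_enorm_mul_inv_le_duality`).
4. **The key integral** (§3–§4): `∫_{ℝ³} r(y) ((d₁d₂)⁻¹ − t)₊ dy ≤ π²/(2t)`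
   (`lintegral_cylRadius_mul_orbitKernel_sub_le`). Cylindrical coordinates
   (`lintegral_comp_cylRadius_eq`: `cylSplit` of `CylindricalIntegration`, then polar coordinates in
   the horizontal plane, Mathlib `lintegral_comp_polarCoord_symm`) turn it into
   `2π ∫∫_{b>0} b² ((d₁d₂)⁻¹ − t)₊ db dh` with `d₁d₂ = √(((a−b)²+h²)((a+b)²+h²)) = |ζ² − a²|`,
   `ζ = b + ih`, `a = r(x)` (`orbitProduct_eq_sq_add_sq`); bounding `b² ≤ |ζ|²` and substituting
   `w = ζ² − a²` (real form `(b,h) ↦ (b²−h²−a², 2bh)`, Jacobian `4|ζ|²`, injective on `b > 0`;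
   Mathlib's change of variables `lintegral_image_eq_lintegral_abs_det_fderiv_mul`) gives
   `≤ (2π/4) ∫_{ℝ²} (|w|⁻¹ − t)₊ dw = (π/2)(π/t)` (`lintegral_halfPlane_sq_mul_orbitKernel_sub_le`,
   `lintegral_ofReal_inv_norm_sub`).
5. Hence `‖(K₃ ∗ w)(x)‖ ≤ tA/(4π) + πM/(8t)` for every `t > 0` (`A = ∫‖w‖`); `t = 2πs/A`,
   `s = √(AM/8)` gives `s`.

All integrals of steps 2–4 are Lebesgue integrals in `ℝ≥0∞` (no integrability side conditions).
WHAT THIS IS NOT: a kinematic inequality for the Biot–Savart law; no Navier–Stokes dynamics.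
Consumers (cell `ns-blowup`, crux `HeredityAtOne` negative lane): the dynamic all-time speed cap
`AxisymNoSwirlSpeedCap` and the `C = 3` cap levers (`NoSwirlCapThree`) can be re-instantiated at
`C = 1/(2√2)`, inside the window `[0.2105, 0.4652)` recorded there (K-row KJ-16).

## Mathlib / tree search

Tree (used): `biotSavart`, `biotSavartKernel`, `biotSavart_zero` (`Vorticity`);
`norm_biotSavartKernel_le` (`BiotSavartBounds`); `rotZ`, `rotZ_apply_*`, `norm_rotZ`,
`IsAxisymmetric`, `cylRadius`, `cylRadius_sq`, `continuous_cylRadius` (`AxisymmetricEuler`); `rotZLIE`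
(`AxisymmetricVorticityTransport`); `cylSplit`, `cylSplit_apply_fst`, `measurePreserving_cylSplit`
(`CylindricalIntegration`); `norm_biotSavart_le_sqrt_of_norm_le_mul_cylRadius` (`C = 3`, not used in
the proofs). Mathlib: `HarmonicContOnCl.circleAverage_poissonKernel_smul`, `poissonKernel_def`,
`circleMap`, `norm_circleMap_zero`, `Complex.exp_ofReal_mul_I_re/im`,
`lintegral_comp_polarCoord_symm`, `polarCoord_symm_apply`, `Matrix.toLin_finTwoProd_toContinuousLinearMap`,
`LinearMap.det_toLin`, `Matrix.det_fin_two_of`, `lintegral_image_eq_lintegral_abs_det_fderiv_mul`,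
`MeasurePreserving.lintegral_comp_emb`, `lintegral_prod`, `lintegral_lintegral_swap`,
`Measure.prod_restrict`, `Measure.volume_eq_prod`, `lintegral_sub_right_eq_self`,
`EuclideanSpace.volume_preserving_symm_measurableEquiv_toLp`, `volume_preserving_finTwoArrow`,
`ofReal_integral_eq_lintegral_ofReal`, `integral_id`. `lean search 'sqrt_div_eight|orbitKernel|
inv_norm_sub_rotZ'` (2026-08-26): nothing before this file.

## References

* Th. Gallay, V. Šverák, *Remarks on the Cauchy problem for the axisymmetric Navier–Stokes
  equations*, Confluentes Math. 7 (2015) 67–92 = arXiv:1510.01036, Prop. 2.6 (2.14), p. 8.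
  [GallaySverak2016]
* H. Feng, V. Šverák, *On the Cauchy problem for axi-symmetric vortex rings*, Arch. Ration.
  Mech. Anal. 215 (2015) 89–123 (the original form of (2.14)).
* A. J. Majda, A. L. Bertozzi, *Vorticity and Incompressible Flow*, CUP 2002, (2.10)–(2.12).
  [MajdaBertozziCUP2002]
-/

noncomputable section

open MeasureTheory Set Function Filter Metric Real
open _root_.Topology
open scoped ENNReal NNReal

namespace Literature.Analysis.FluidPDE

/-! ### §1 The orbit of the kernel `|x − y|⁻²`: `∫₀^{2π} |x − R_θ y|⁻² dθ = 2π/(d₁ d₂)` -/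

section Orbit

/-- **`‖x − R_θ y‖²` along an orbit**: with `P = x₀y₀ + x₁y₁`, `Q = x₁y₀ − x₀y₁`,
`‖x − R_θ y‖² = r(x)² + r(y)² + (x₂ − y₂)² − 2 (P cos θ + Q sin θ)`. [folklore] -/
private theorem norm_sub_rotZ_sq_eq (x y : EuclideanSpace ℝ (Fin 3)) (θ : ℝ) :
    ‖x - rotZ θ y‖ ^ 2 = cylRadius x ^ 2 + cylRadius y ^ 2 + (x 2 - y 2) ^ 2 -
      2 * ((x 0 * y 0 + x 1 * y 1) * Real.cos θ + (x 1 * y 0 - x 0 * y 1) * Real.sin θ) := by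
  rw [EuclideanSpace.norm_eq, Real.sq_sqrt (Finset.sum_nonneg fun i _ => sq_nonneg _),
    cylRadius_sq, cylRadius_sq]
  simp only [Fin.sum_univ_three, Real.norm_eq_abs, sq_abs, PiLp.sub_apply, rotZ_apply_zero,
    rotZ_apply_one, rotZ_apply_two]
  linear_combination (y 0 ^ 2 + y 1 ^ 2) * Real.sin_sq_add_cos_sq θ

/-- Lagrange's identity for the horizontal components: `P² + Q² = r(x)² r(y)²`. [folklore] -/
private theorem sq_add_sq_eq_cylRadius_sq_mul (x y : EuclideanSpace ℝ (Fin 3)) :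
    (x 0 * y 0 + x 1 * y 1) ^ 2 + (x 1 * y 0 - x 0 * y 1) ^ 2 = cylRadius x ^ 2 * cylRadius y ^ 2 := by
  rw [cylRadius_sq, cylRadius_sq]; ring

/-- **Uniform lower bound along an orbit**: `‖x − R_θ y‖² ≥ (r(x) − r(y))² + (x₂ − y₂)²` (the
squared distance, in the meridian half-plane, from `(r(y), y₂)` to `(r(x), x₂)`). [folklore] -/
private theorem sq_meridianDist_le_norm_sub_rotZ_sq (x y : EuclideanSpace ℝ (Fin 3)) (θ : ℝ) :
    (cylRadius x - cylRadius y) ^ 2 + (x 2 - y 2) ^ 2 ≤ ‖x - rotZ θ y‖ ^ 2 := by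
  rw [norm_sub_rotZ_sq_eq]
  set P := x 0 * y 0 + x 1 * y 1
  set Q := x 1 * y 0 - x 0 * y 1
  have hL := sq_add_sq_eq_cylRadius_sq_mul x y
  have ha := cylRadius_nonneg x
  have hb := cylRadius_nonneg y
  -- `P cos θ + Q sin θ ≤ √(P² + Q²) = r(x) r(y)`
  have hcs : P * Real.cos θ + Q * Real.sin θ ≤ cylRadius x * cylRadius y := by
    have h1 : (P * Real.cos θ + Q * Real.sin θ) ^ 2 ≤ (cylRadius x * cylRadius y) ^ 2 := by
      nlinarith [sq_nonneg (P * Real.sin θ - Q * Real.cos θ), Real.sin_sq_add_cos_sq θ,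
        mul_pow (cylRadius x) (cylRadius y) 2]
    exact (abs_le_of_sq_le_sq' h1 (mul_nonneg ha hb)).2
  nlinarith [hcs]

/-- **The orbit integral of `|x − y|⁻²`, exactly**: if `(r(y), y₂) ≠ (r(x), x₂)` then
`∫₀^{2π} ‖x − R_θ y‖⁻² dθ = 2π / (d₁ d₂)`, `d₁ d₂ = √(((r(x)−r(y))² + h²)((r(x)+r(y))² + h²))`,
`h = x₂ − y₂` (the distances in the meridian half-plane from `(r(y), y₂)` to `(± r(x), x₂)`).
Proof: with `α = r(x)² + r(y)² + h²`, `ρ² = (α + d₁d₂)/2` and the pole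
`w₀ = (x·y_h + i (x × y)_h)/ρ` (`|w₀|² = (α − d₁d₂)/2 < ρ²`), one has
`‖x − R_θ y‖² = |ρ e^{iθ} − w₀|²`, so the integrand is `(ρ² − |w₀|²)⁻¹` times the Poisson kernel of
the disc `|z| < ρ`, whose circle average is `1` (Mathlib's Poisson formula for the constant `1`).
[folklore] -/
private theorem integral_inv_norm_sub_rotZ_sq (x y : EuclideanSpace ℝ (Fin 3))
    (hD : 0 < ((cylRadius x - cylRadius y) ^ 2 + (x 2 - y 2) ^ 2) *
      ((cylRadius x + cylRadius y) ^ 2 + (x 2 - y 2) ^ 2)) :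
    ∫ θ in (0 : ℝ)..2 * π, (‖x - rotZ θ y‖ ^ 2)⁻¹ =
      2 * π / Real.sqrt (((cylRadius x - cylRadius y) ^ 2 + (x 2 - y 2) ^ 2) *
        ((cylRadius x + cylRadius y) ^ 2 + (x 2 - y 2) ^ 2)) := by
  have hn : ∀ θ : ℝ, ‖x - rotZ θ y‖ ^ 2 = cylRadius x ^ 2 + cylRadius y ^ 2 + (x 2 - y 2) ^ 2 -
      2 * ((x 0 * y 0 + x 1 * y 1) * Real.cos θ + (x 1 * y 0 - x 0 * y 1) * Real.sin θ) :=
    norm_sub_rotZ_sq_eq x y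
  have hPQ : (x 0 * y 0 + x 1 * y 1) ^ 2 + (x 1 * y 0 - x 0 * y 1) ^ 2 =
      cylRadius x ^ 2 * cylRadius y ^ 2 := sq_add_sq_eq_cylRadius_sq_mul x y
  set a := cylRadius x with hadef
  set b := cylRadius y with hbdef
  set h := x 2 - y 2 with hhdef
  set P := x 0 * y 0 + x 1 * y 1 with hPdef
  set Q := x 1 * y 0 - x 0 * y 1 with hQdef
  set α := a ^ 2 + b ^ 2 + h ^ 2 with hαdef
  set D := Real.sqrt (((a - b) ^ 2 + h ^ 2) * ((a + b) ^ 2 + h ^ 2)) with hDdef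
  have hD0 : 0 < D := Real.sqrt_pos.2 hD
  have hD2 : D ^ 2 = α ^ 2 - 4 * (a ^ 2 * b ^ 2) := by
    rw [hDdef, Real.sq_sqrt hD.le, hαdef]; ring
  have hα0 : 0 ≤ α := by positivity
  have hDα : D ≤ α := by
    refine (abs_le_of_sq_le_sq' ?_ hα0).2
    nlinarith [sq_nonneg (a * b)]
  set ρ := Real.sqrt ((α + D) / 2) with hρdef
  have hρ0 : 0 < ρ := Real.sqrt_pos.2 (by linarith)
  have hρ2 : ρ ^ 2 = (α + D) / 2 := Real.sq_sqrt (by linarith)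
  have hPQρ : (P ^ 2 + Q ^ 2) / ρ ^ 2 = (α - D) / 2 := by
    rw [hPQ, div_eq_iff (by positivity), hρ2]
    linear_combination (1 / 4 : ℝ) * hD2
  set w₀ : ℂ := ⟨P / ρ, Q / ρ⟩ with hw₀def
  have hw₀2 : ‖w₀‖ ^ 2 = (α - D) / 2 := by
    rw [Complex.sq_norm, Complex.normSq_mk, ← hPQρ]
    field_simp
  have hw₀ : w₀ ∈ ball (0 : ℂ) ρ := by
    rw [mem_ball_zero_iff]
    refine lt_of_pow_lt_pow_left₀ 2 hρ0.le ?_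
    rw [hw₀2, hρ2]; linarith
  -- the squared distance along the circle is the squared distance along the orbit
  have hdist : ∀ θ : ℝ, ‖circleMap 0 ρ θ - w₀‖ ^ 2 = ‖x - rotZ θ y‖ ^ 2 := by
    intro θ
    have hre : (circleMap 0 ρ θ - w₀).re = ρ * Real.cos θ - P / ρ := by
      simp [circleMap, Complex.exp_ofReal_mul_I_re, Complex.exp_ofReal_mul_I_im, hw₀def]
    have him : (circleMap 0 ρ θ - w₀).im = ρ * Real.sin θ - Q / ρ := by
      simp [circleMap, Complex.exp_ofReal_mul_I_re, Complex.exp_ofReal_mul_I_im, hw₀def]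
    rw [Complex.sq_norm, Complex.normSq_apply, hre, him, hn θ]
    have hρne : ρ ≠ 0 := hρ0.ne'
    have e1 : (ρ * Real.cos θ - P / ρ) * (ρ * Real.cos θ - P / ρ) +
        (ρ * Real.sin θ - Q / ρ) * (ρ * Real.sin θ - Q / ρ) =
        ρ ^ 2 * (Real.cos θ ^ 2 + Real.sin θ ^ 2) - 2 * (P * Real.cos θ + Q * Real.sin θ) +
          (P ^ 2 + Q ^ 2) / ρ ^ 2 := by
      field_simp; ring
    rw [e1, hPQρ, Real.cos_sq_add_sin_sq, mul_one, hρ2, hαdef]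
    ring
  -- the integrand is `D⁻¹ ×` the Poisson kernel of the disc `|z| < ρ` with pole `w₀`
  have hker : ∀ θ : ℝ, poissonKernel 0 w₀ (circleMap 0 ρ θ) = D * (‖x - rotZ θ y‖ ^ 2)⁻¹ := by
    intro θ
    rw [poissonKernel_def]
    simp only [sub_zero]
    rw [norm_circleMap_zero, sq_abs, hdist θ, hρ2, hw₀2, div_eq_mul_inv]
    congr 1; ring
  have hP := (InnerProductSpace.harmonicContOnCl_const (c := (1 : ℝ))
    (s := ball (0 : ℂ) ρ)).circleAverage_poissonKernel_smul hw₀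
  rw [Real.circleAverage_def] at hP
  have e : (fun θ : ℝ => (poissonKernel 0 w₀ • fun _ : ℂ => (1 : ℝ)) (circleMap 0 ρ θ)) =
      fun θ => D * (‖x - rotZ θ y‖ ^ 2)⁻¹ := by
    funext θ; simp [Pi.smul_apply', hker θ]
  rw [e, intervalIntegral.integral_const_mul, smul_eq_mul] at hP
  have hπ : 0 < 2 * π := by positivity
  rw [eq_div_iff hD0.ne']
  have := congrArg (fun t => 2 * π * t) hP
  rw [← mul_assoc, mul_inv_cancel₀ hπ.ne', one_mul, mul_one] at this
  linarith [this]

/-- The orbit integral in `ℝ≥0∞` form over `Ioc 0 (2π)`: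
`∫⁻ ofReal ‖x − R_θ y‖⁻² = ofReal (2π/(d₁d₂))` off the orbit of `x`. [folklore] -/
private theorem lintegral_inv_norm_sub_rotZ_sq (x y : EuclideanSpace ℝ (Fin 3))
    (hD : 0 < ((cylRadius x - cylRadius y) ^ 2 + (x 2 - y 2) ^ 2) *
      ((cylRadius x + cylRadius y) ^ 2 + (x 2 - y 2) ^ 2)) :
    ∫⁻ θ in Ioc 0 (2 * π), ENNReal.ofReal ((‖x - rotZ θ y‖ ^ 2)⁻¹) =
      ENNReal.ofReal (2 * π / Real.sqrt (((cylRadius x - cylRadius y) ^ 2 + (x 2 - y 2) ^ 2) *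
        ((cylRadius x + cylRadius y) ^ 2 + (x 2 - y 2) ^ 2))) := by
  have hm : 0 < (cylRadius x - cylRadius y) ^ 2 + (x 2 - y 2) ^ 2 := by
    rcases (show (0 : ℝ) ≤ (cylRadius x - cylRadius y) ^ 2 + (x 2 - y 2) ^ 2 by positivity).eq_or_lt
      with h | h
    · rw [← h, zero_mul] at hD; exact (lt_irrefl _ hD).elim
    · exact h
  have hpos : ∀ θ : ℝ, 0 < ‖x - rotZ θ y‖ ^ 2 := fun θ =>
    hm.trans_le (sq_meridianDist_le_norm_sub_rotZ_sq x y θ)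
  have hcont : Continuous fun θ : ℝ => (‖x - rotZ θ y‖ ^ 2)⁻¹ := by
    have h1 : Continuous fun θ : ℝ => ‖x - rotZ θ y‖ ^ 2 := by
      simp_rw [norm_sub_rotZ_sq_eq]; fun_prop
    exact h1.inv₀ fun θ => (hpos θ).ne'
  rw [← integral_inv_norm_sub_rotZ_sq x y hD, intervalIntegral.integral_of_le (by positivity),
    ← ofReal_integral_eq_lintegral_ofReal]
  · exact (hcont.integrableOn_Icc (a := 0) (b := 2 * π)).mono_set Ioc_subset_Icc_self
  · exact ae_of_all _ fun θ => by positivity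

end Orbit

/-! ### §2 Rotation averaging and the orbit-averaged majorant of the Biot–Savart integral -/

section Averaging

/-- `(θ, y) ↦ R_θ y` is jointly continuous (re-proved; private in the `C = 3` file). [folklore] -/
private theorem continuous_rotZ_pair :
    Continuous fun p : ℝ × EuclideanSpace ℝ (Fin 3) => rotZ p.1 p.2 := by
  unfold rotZ
  refine (PiLp.continuous_toLp 2 _).comp ?_
  refine continuous_pi fun i => ?_
  have h0 : Continuous fun p : ℝ × EuclideanSpace ℝ (Fin 3) => p.2 0 :=
    (PiLp.continuous_apply 2 _ 0).comp continuous_snd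
  have h1 : Continuous fun p : ℝ × EuclideanSpace ℝ (Fin 3) => p.2 1 :=
    (PiLp.continuous_apply 2 _ 1).comp continuous_snd
  have h2 : Continuous fun p : ℝ × EuclideanSpace ℝ (Fin 3) => p.2 2 :=
    (PiLp.continuous_apply 2 _ 2).comp continuous_snd
  have hc : Continuous fun p : ℝ × EuclideanSpace ℝ (Fin 3) => Real.cos p.1 :=
    Real.continuous_cos.comp continuous_fst
  have hs : Continuous fun p : ℝ × EuclideanSpace ℝ (Fin 3) => Real.sin p.1 :=
    Real.continuous_sin.comp continuous_fst
  fin_cases i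
  · exact ((hc.mul h0).sub (hs.mul h1)).congr fun p => by simp
  · exact ((hs.mul h0).add (hc.mul h1)).congr fun p => by simp
  · exact h2.congr fun p => by simp

/-- Substituting `y ↦ R_θ y` (volume-preserving): for a rotation-invariant weight `a`,
`∫ a(y) G(R_θ y) dy = ∫ a(y) G(y) dy` (re-proved; private in the `C = 3` file). [folklore] -/
private theorem lintegral_mul_comp_rotZ_eq' {a G : EuclideanSpace ℝ (Fin 3) → ℝ≥0∞}
    (ha : ∀ θ y, a (rotZ θ y) = a y) (θ : ℝ) :
    ∫⁻ y, a y * G (rotZ θ y) = ∫⁻ y, a y * G y := by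
  have hmp : MeasurePreserving (rotZ θ) (volume : Measure (EuclideanSpace ℝ (Fin 3))) volume :=
    (rotZLIE θ).measurePreserving
  have hme : MeasurableEmbedding (rotZ θ) := (rotZLIE θ).toHomeomorph.measurableEmbedding
  have h := hmp.lintegral_comp_emb hme (fun z => a z * G z)
  simp only [ha] at h
  exact h

/-- **Rotation averaging (Tonelli)** over `[0, 2π]`: for a measurable rotation-invariant weight
`a ≥ 0` and a measurable kernel `G ≥ 0`, `2π ∫ a G = ∫ a(y) (∫₀^{2π} G(R_θ y) dθ) dy`
(the `C = 3` file's private lemma, on `Ioc 0 (2π)` instead of `Ioc (−π) π`). [folklore] -/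
private theorem ofReal_two_pi_mul_lintegral_mul_eq_lintegral_orbit
    {a G : EuclideanSpace ℝ (Fin 3) → ℝ≥0∞}
    (ha : ∀ θ y, a (rotZ θ y) = a y) (ham : Measurable a) (hG : Measurable G) :
    ENNReal.ofReal (2 * π) * ∫⁻ y, a y * G y =
      ∫⁻ y, a y * ∫⁻ θ in Ioc 0 (2 * π), G (rotZ θ y) := by
  have hvol : volume (Ioc 0 (2 * π)) = ENNReal.ofReal (2 * π) := by
    rw [Real.volume_Ioc]; congr 1; ring
  have hrot : Measurable fun p : ℝ × EuclideanSpace ℝ (Fin 3) => rotZ p.1 p.2 :=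
    continuous_rotZ_pair.measurable
  calc ENNReal.ofReal (2 * π) * ∫⁻ y, a y * G y
      = ∫⁻ _ in Ioc 0 (2 * π), ∫⁻ y, a y * G y := by rw [setLIntegral_const, hvol, mul_comm]
    _ = ∫⁻ θ in Ioc 0 (2 * π), ∫⁻ y, a y * G (rotZ θ y) :=
        lintegral_congr fun θ => (lintegral_mul_comp_rotZ_eq' ha θ).symm
    _ = ∫⁻ y, ∫⁻ θ in Ioc 0 (2 * π), a y * G (rotZ θ y) := by
        have hF : Measurable
            (fun p : ℝ × EuclideanSpace ℝ (Fin 3) => a p.2 * G (rotZ p.1 p.2)) :=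
          (ham.comp measurable_snd).mul (hG.comp hrot)
        exact lintegral_lintegral_swap hF.aemeasurable
    _ = ∫⁻ y, a y * ∫⁻ θ in Ioc 0 (2 * π), G (rotZ θ y) := by
        refine lintegral_congr fun y => ?_
        have hm0 : Measurable fun θ : ℝ => rotZ θ y :=
          (continuous_rotZ_pair.comp (continuous_id.prodMk continuous_const)).measurable
        have hm : Measurable fun θ : ℝ => G (rotZ θ y) := hG.comp hm0
        rw [lintegral_const_mul _ hm]

/-- The horizontal hyperplanes `{y₂ = c}` are Lebesgue-null in `ℝ³`. [folklore] -/
private theorem volume_horizontalPlane_eq_zero (c : ℝ) :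
    volume {y : EuclideanSpace ℝ (Fin 3) | y 2 = c} = 0 := by
  have hset : {y : EuclideanSpace ℝ (Fin 3) | y 2 = c} =
      cylSplit ⁻¹' (({c} : Set ℝ) ×ˢ (univ : Set (EuclideanSpace ℝ (Fin 2)))) := by
    ext y; simp [cylSplit_apply_fst]
  rw [hset, measurePreserving_cylSplit.measure_preimage
    ((measurableSet_singleton c).prod MeasurableSet.univ).nullMeasurableSet]
  rw [show (volume : Measure (ℝ × EuclideanSpace ℝ (Fin 2))) = volume.prod volume from rfl,
    Measure.prod_prod, Real.volume_singleton, zero_mul]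

/-- Off the horizontal hyperplane through `x`, the point `y` is off the orbit of `x`:
`d₁ d₂ > 0`. [folklore] -/
private theorem orbitProduct_pos_of_apply_two_ne {x y : EuclideanSpace ℝ (Fin 3)} (h : y 2 ≠ x 2) :
    0 < ((cylRadius x - cylRadius y) ^ 2 + (x 2 - y 2) ^ 2) *
      ((cylRadius x + cylRadius y) ^ 2 + (x 2 - y 2) ^ 2) := by
  have h2 : 0 < (x 2 - y 2) ^ 2 := by
    have : x 2 - y 2 ≠ 0 := sub_ne_zero.2 (Ne.symm h)
    positivity
  exact mul_pos (by positivity) (by positivity)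

variable {w : EuclideanSpace ℝ (Fin 3) → EuclideanSpace ℝ (Fin 3)}

/-- **The orbit-averaged kernel**: for `w` with rotation-invariant norm,
`∫ ‖w(y)‖ ‖x − y‖⁻² dy = ∫ ‖w(y)‖ (d₁ d₂)⁻¹ dy` — rotation averaging and the exact orbit
integral `integral_inv_norm_sub_rotZ_sq` (the orbit of `x`, where `d₁ d₂ = 0`, lies in the null
hyperplane `{y₂ = x₂}`). [folklore] -/
private theorem lintegral_enorm_mul_inv_norm_sq_eq_orbit (hwc : Continuous w)
    (hw : ∀ θ y, ‖w (rotZ θ y)‖ = ‖w y‖) (x : EuclideanSpace ℝ (Fin 3)) :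
    ∫⁻ y, ‖w y‖ₑ * ENNReal.ofReal ((‖x - y‖ ^ 2)⁻¹) =
      ∫⁻ y, ‖w y‖ₑ * ENNReal.ofReal ((Real.sqrt (((cylRadius x - cylRadius y) ^ 2 +
        (x 2 - y 2) ^ 2) * ((cylRadius x + cylRadius y) ^ 2 + (x 2 - y 2) ^ 2)))⁻¹) := by
  have hπ : 0 < 2 * π := by positivity
  have ha : ∀ θ y, ‖w (rotZ θ y)‖ₑ = ‖w y‖ₑ := fun θ y => by
    rw [← ofReal_norm, ← ofReal_norm, hw θ y]
  have ham : Measurable fun y => ‖w y‖ₑ := hwc.measurable.enorm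
  have hG : Measurable fun y : EuclideanSpace ℝ (Fin 3) => ENNReal.ofReal ((‖x - y‖ ^ 2)⁻¹) :=
    ((measurable_const.sub measurable_id).norm.pow_const 2).inv.ennreal_ofReal
  have h1 := ofReal_two_pi_mul_lintegral_mul_eq_lintegral_orbit (G := fun y =>
    ENNReal.ofReal ((‖x - y‖ ^ 2)⁻¹)) ha ham hG
  -- replace the orbit integral by its value, almost everywhere
  have hae : (fun y => ‖w y‖ₑ * ∫⁻ θ in Ioc 0 (2 * π), ENNReal.ofReal ((‖x - rotZ θ y‖ ^ 2)⁻¹))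
      =ᵐ[volume] fun y => ‖w y‖ₑ * ENNReal.ofReal (2 * π / Real.sqrt (((cylRadius x -
        cylRadius y) ^ 2 + (x 2 - y 2) ^ 2) * ((cylRadius x + cylRadius y) ^ 2 +
          (x 2 - y 2) ^ 2))) := by
    have hnull := volume_horizontalPlane_eq_zero (x 2)
    rw [Filter.EventuallyEq, ae_iff]
    refine measure_mono_null (fun y hy => ?_) hnull
    by_contra hne
    exact hy (by rw [lintegral_inv_norm_sub_rotZ_sq x y (orbitProduct_pos_of_apply_two_ne hne)])
  rw [lintegral_congr_ae hae] at h1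
  have h2 : ∫⁻ y, ‖w y‖ₑ * ENNReal.ofReal (2 * π / Real.sqrt (((cylRadius x -
        cylRadius y) ^ 2 + (x 2 - y 2) ^ 2) * ((cylRadius x + cylRadius y) ^ 2 +
          (x 2 - y 2) ^ 2))) = ENNReal.ofReal (2 * π) *
      ∫⁻ y, ‖w y‖ₑ * ENNReal.ofReal ((Real.sqrt (((cylRadius x - cylRadius y) ^ 2 +
        (x 2 - y 2) ^ 2) * ((cylRadius x + cylRadius y) ^ 2 + (x 2 - y 2) ^ 2)))⁻¹) := by
    have hm : Measurable fun y : EuclideanSpace ℝ (Fin 3) => ‖w y‖ₑ *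
        ENNReal.ofReal ((Real.sqrt (((cylRadius x - cylRadius y) ^ 2 +
          (x 2 - y 2) ^ 2) * ((cylRadius x + cylRadius y) ^ 2 + (x 2 - y 2) ^ 2)))⁻¹) := by
      refine ham.mul (Measurable.ennreal_ofReal ?_)
      have hc : Measurable (cylRadius : EuclideanSpace ℝ (Fin 3) → ℝ) :=
        continuous_cylRadius.measurable
      have h2m : Measurable fun y : EuclideanSpace ℝ (Fin 3) => y 2 :=
        (PiLp.continuous_apply 2 _ 2).measurable
      fun_prop
    rw [← lintegral_const_mul _ hm]
    refine lintegral_congr fun y => ?_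
    rw [← mul_assoc, mul_comm (ENNReal.ofReal (2 * π)), mul_assoc, ← ENNReal.ofReal_mul hπ.le,
      div_eq_mul_inv]
  rw [h2] at h1
  exact (ENNReal.mul_right_inj (ENNReal.ofReal_pos.2 hπ).ne' ENNReal.ofReal_ne_top).1 h1

/-- **The orbit-averaged majorant of the Biot–Savart integral**: for `w` with rotation-invariant
norm, `‖(K₃ ∗ w)(x)‖ ≤ (4π)⁻¹ ∫ ‖w(y)‖ (d₁ d₂)⁻¹ dy` (in `ℝ≥0∞`), where `d₁, d₂` are the distances in
the meridian half-plane from `(r(y), y₂)` to `(r(x), x₂)` and `(−r(x), x₂)`. [folklore] -/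
private theorem enorm_biotSavart_le_lintegral_orbitKernel (hwc : Continuous w)
    (hw : ∀ θ y, ‖w (rotZ θ y)‖ = ‖w y‖) (x : EuclideanSpace ℝ (Fin 3)) :
    ‖biotSavart w x‖ₑ ≤ ENNReal.ofReal ((4 * π)⁻¹) *
      ∫⁻ y, ‖w y‖ₑ * ENNReal.ofReal ((Real.sqrt (((cylRadius x - cylRadius y) ^ 2 +
        (x 2 - y 2) ^ 2) * ((cylRadius x + cylRadius y) ^ 2 + (x 2 - y 2) ^ 2)))⁻¹) := by
  rw [← lintegral_enorm_mul_inv_norm_sq_eq_orbit hwc hw x]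
  have hc : (0 : ℝ) ≤ (4 * π)⁻¹ := by positivity
  have hpt : ∀ y, ‖biotSavartKernel (x - y) (w y)‖ₑ ≤ ENNReal.ofReal ((4 * π)⁻¹) *
      (‖w y‖ₑ * ENNReal.ofReal ((‖x - y‖ ^ 2)⁻¹)) := by
    intro y
    rw [← ofReal_norm (w y), ← ofReal_norm, ← ENNReal.ofReal_mul (norm_nonneg _),
      ← ENNReal.ofReal_mul hc]
    refine ENNReal.ofReal_le_ofReal ?_
    rw [← mul_assoc]
    exact norm_biotSavartKernel_le _ _
  rw [biotSavart]
  refine (enorm_integral_le_lintegral_enorm _).trans ((lintegral_mono hpt).trans ?_)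
  rw [lintegral_const_mul' _ _ ENNReal.ofReal_ne_top]

end Averaging

/-! ### §3 Two planar integrals

`∫_{ℝ²} (|p|⁻¹ − t)₊ dp = π/t` (polar coordinates), and THE KEY ESTIMATE
`∫∫_{b>0} b² ((d₁d₂)⁻¹ − t)₊ db dh ≤ π/(4t)`, `d₁d₂ = √(((a−b)²+h²)((a+b)²+h²)) = |ζ² − a²|`
(`ζ = b + ih`): bound `b² ≤ |ζ|²` and substitute `w = ζ² − a²` (Jacobian `4|ζ|²`, injective on the
right half-plane), which turns the integral into `(1/4) ∫ (|w|⁻¹ − t)₊ dw` over the image. -/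

section Planar

/-- **`∫_{ℝ²} (|p|⁻¹ − t)₊ dp = π/t`** for `t > 0` (polar coordinates: `2π ∫₀^{1/t} (1 − tρ) dρ`).
[folklore] -/
private theorem lintegral_ofReal_inv_norm_sub (t : ℝ) (ht : 0 < t) :
    ∫⁻ p : ℝ × ℝ, ENNReal.ofReal ((Real.sqrt (p.1 ^ 2 + p.2 ^ 2))⁻¹ - t) =
      ENNReal.ofReal (π / t) := by
  rw [← lintegral_comp_polarCoord_symm, polarCoord_target]
  have hcongr : ∀ p ∈ Ioi (0 : ℝ) ×ˢ Ioo (-π) π,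
      ENNReal.ofReal p.1 • ENNReal.ofReal ((Real.sqrt ((polarCoord.symm p).1 ^ 2 +
        (polarCoord.symm p).2 ^ 2))⁻¹ - t) = ENNReal.ofReal (1 - t * p.1) := by
    rintro ⟨r, θ⟩ ⟨hr, -⟩
    have hr : 0 < r := hr
    have hsq : Real.sqrt ((polarCoord.symm (r, θ)).1 ^ 2 + (polarCoord.symm (r, θ)).2 ^ 2) = r := by
      rw [polarCoord_symm_apply]
      simp only
      rw [show (r * Real.cos θ) ^ 2 + (r * Real.sin θ) ^ 2 = r ^ 2 by
        linear_combination r ^ 2 * Real.cos_sq_add_sin_sq θ, Real.sqrt_sq hr.le]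
    rw [hsq, smul_eq_mul, ← ENNReal.ofReal_mul hr.le]
    congr 1
    field_simp
  have hmeas : Measurable fun p : ℝ × ℝ => ENNReal.ofReal (1 - t * p.1) := by fun_prop
  rw [setLIntegral_congr_fun (measurableSet_Ioi.prod measurableSet_Ioo) hcongr,
    Measure.volume_eq_prod, ← Measure.prod_restrict, lintegral_prod _ hmeas.aemeasurable]
  simp only [lintegral_const, Measure.restrict_apply MeasurableSet.univ, univ_inter,
    Real.volume_Ioo]
  rw [lintegral_mul_const _ (by fun_prop : Measurable fun r : ℝ => ENNReal.ofReal (1 - t * r))]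
  -- `∫₀^∞ (1 − tρ)₊ dρ = 1/(2t)`
  have hI : ∫⁻ r in Ioi (0 : ℝ), ENNReal.ofReal (1 - t * r) = ENNReal.ofReal (1 / (2 * t)) := by
    have hsplit : Ioi (0 : ℝ) = Ioc 0 (1 / t) ∪ Ioi (1 / t) :=
      (Ioc_union_Ioi_eq_Ioi (by positivity)).symm
    rw [hsplit, lintegral_union measurableSet_Ioi
      (Set.disjoint_left.2 fun r hr hr' => (not_lt.2 hr.2) hr')]
    have hzero : ∫⁻ r in Ioi (1 / t), ENNReal.ofReal (1 - t * r) = 0 := by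
      refine (setLIntegral_congr_fun measurableSet_Ioi (fun r hr => ?_)).trans
        (lintegral_zero)
      have hr : 1 / t < r := hr
      rw [ENNReal.ofReal_eq_zero]
      rw [div_lt_iff₀ ht] at hr
      linarith
    rw [hzero, add_zero, ← ofReal_integral_eq_lintegral_ofReal]
    · congr 1
      have ht' : t ≠ 0 := ht.ne'
      rw [← intervalIntegral.integral_of_le (by positivity), intervalIntegral.integral_sub,
        intervalIntegral.integral_const, intervalIntegral.integral_const_mul, integral_id,
        smul_eq_mul]
      · field_simp
        ring
      · exact intervalIntegrable_const
      · exact (continuous_const.mul continuous_id').intervalIntegrable _ _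
    · exact (by fun_prop : Continuous fun r : ℝ => 1 - t * r).integrableOn_Ioc
    · refine (ae_restrict_iff' measurableSet_Ioc).2 (ae_of_all _ fun r hr => ?_)
      have h2 : r ≤ 1 / t := hr.2
      rw [le_div_iff₀ ht] at h2
      simp only [Pi.zero_apply]
      linarith
  rw [hI, ← ENNReal.ofReal_mul (by positivity)]
  congr 1
  field_simp
  ring

/-- The derivative of the squaring map `(b, h) ↦ (b² − h² − a², 2bh)` (real form of
`ζ ↦ ζ² − a²`). [folklore] -/
private theorem hasFDerivAt_sqMap (a : ℝ) (q : ℝ × ℝ) :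
    HasFDerivAt (fun q : ℝ × ℝ => (q.1 ^ 2 - q.2 ^ 2 - a ^ 2, 2 * q.1 * q.2))
      (LinearMap.toContinuousLinearMap (Matrix.toLin (Module.Basis.finTwoProd ℝ) (Module.Basis.finTwoProd ℝ)
        !![2 * q.1, -2 * q.2; 2 * q.2, 2 * q.1])) q := by
  rw [Matrix.toLin_finTwoProd_toContinuousLinearMap]
  convert! HasFDerivAt.prodMk (𝕜 := ℝ)
    ((((hasFDerivAt_fst (p := q)).mul (hasFDerivAt_fst (p := q))).sub
      ((hasFDerivAt_snd (p := q)).mul (hasFDerivAt_snd (p := q)))).sub_const (a ^ 2))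
    (((hasFDerivAt_fst (p := q)).mul (hasFDerivAt_snd (p := q))).const_mul (2 : ℝ))
    using 2 <;>
  (ext <;> simp <;> ring)

/-- Its Jacobian determinant: `4 (b² + h²)`. [folklore] -/
private theorem det_sqMap (q : ℝ × ℝ) :
    (LinearMap.toContinuousLinearMap (Matrix.toLin (Module.Basis.finTwoProd ℝ) (Module.Basis.finTwoProd ℝ)
        !![2 * q.1, -2 * q.2; 2 * q.2, 2 * q.1])).det = 4 * (q.1 ^ 2 + q.2 ^ 2) := by
  simp only [LinearMap.det_toContinuousLinearMap, LinearMap.det_toLin, Matrix.det_fin_two_of]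
  ring

/-- The squaring map is injective on the right half-plane `b > 0`. [folklore] -/
private theorem injOn_sqMap (a : ℝ) :
    InjOn (fun q : ℝ × ℝ => (q.1 ^ 2 - q.2 ^ 2 - a ^ 2, 2 * q.1 * q.2))
      (Ioi (0 : ℝ) ×ˢ (univ : Set ℝ)) := by
  rintro ⟨b, h⟩ ⟨hb, -⟩ ⟨b', h'⟩ ⟨hb', -⟩ heq
  have hb : 0 < b := hb
  have hb' : 0 < b' := hb'
  simp only [Prod.mk.injEq] at heq
  obtain ⟨h1, h2⟩ := heq
  -- `(b² + h²)² = (b² − h²)² + (2bh)²` is the same for both points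
  have e1 : (b ^ 2 + h ^ 2) ^ 2 = (b ^ 2 - h ^ 2) ^ 2 + (2 * b * h) ^ 2 := by ring
  have e2 : (b' ^ 2 + h' ^ 2) ^ 2 = (b' ^ 2 - h' ^ 2) ^ 2 + (2 * b' * h') ^ 2 := by ring
  have h1' : b ^ 2 - h ^ 2 = b' ^ 2 - h' ^ 2 := by linarith
  have h3 : (b ^ 2 + h ^ 2) ^ 2 = (b' ^ 2 + h' ^ 2) ^ 2 := by rw [e1, e2, h1', h2]
  have h4 : b ^ 2 + h ^ 2 = b' ^ 2 + h' ^ 2 :=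
    (pow_left_inj₀ (by positivity) (by positivity) two_ne_zero).1 h3
  have h5 : b ^ 2 = b' ^ 2 := by linarith
  have h6 : b = b' := (pow_left_inj₀ hb.le hb'.le two_ne_zero).1 h5
  subst h6
  have h7 : h = h' := by
    have : 2 * b * (h - h') = 0 := by linarith
    rcases mul_eq_zero.1 this with h0 | h0
    · exact absurd h0 (by positivity)
    · linarith
  rw [h7]

/-- `d₁ d₂ = |ζ² − a²|`: `((a−b)² + h²)((a+b)² + h²) = (b² − h² − a²)² + (2bh)²`. [folklore] -/
private theorem orbitProduct_eq_sq_add_sq (a b h : ℝ) :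
    ((a - b) ^ 2 + h ^ 2) * ((a + b) ^ 2 + h ^ 2) = (b ^ 2 - h ^ 2 - a ^ 2) ^ 2 + (2 * b * h) ^ 2 := by
  ring

/-- **THE KEY PLANAR ESTIMATE**: for every `a` and `t > 0`,
`∫∫_{b>0} b² ((d₁d₂)⁻¹ − t)₊ db dh ≤ π/(4t)`, `d₁d₂ = √(((a−b)²+h²)((a+b)²+h²))` — bound `b²` by
`b² + h² = |ζ|²`, substitute `w = ζ² − a²` (change of variables
`lintegral_image_eq_lintegral_abs_det_fderiv_mul`, Jacobian `4|ζ|²`, injective on `b > 0`) and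
use `∫ (|w|⁻¹ − t)₊ dw = π/t`. Equality holds in the limit `a → ∞` (thin rings). [folklore] -/
private theorem lintegral_halfPlane_sq_mul_orbitKernel_sub_le (a : ℝ) {t : ℝ} (ht : 0 < t) :
    ∫⁻ q in Ioi (0 : ℝ) ×ˢ (univ : Set ℝ), ENNReal.ofReal (q.1 ^ 2) *
      ENNReal.ofReal ((Real.sqrt (((a - q.1) ^ 2 + q.2 ^ 2) * ((a + q.1) ^ 2 + q.2 ^ 2)))⁻¹ - t) ≤
      ENNReal.ofReal (π / (4 * t)) := by
  set s : Set (ℝ × ℝ) := Ioi (0 : ℝ) ×ˢ (univ : Set ℝ) with hsdef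
  set f : ℝ × ℝ → ℝ × ℝ := fun q => (q.1 ^ 2 - q.2 ^ 2 - a ^ 2, 2 * q.1 * q.2) with hfdef
  set g : ℝ × ℝ → ℝ≥0∞ := fun p => ENNReal.ofReal ((Real.sqrt (p.1 ^ 2 + p.2 ^ 2))⁻¹ - t)
    with hgdef
  have hs : MeasurableSet s := measurableSet_Ioi.prod MeasurableSet.univ
  have hcov := lintegral_image_eq_lintegral_abs_det_fderiv_mul volume hs
    (fun q _ => (hasFDerivAt_sqMap a q).hasFDerivWithinAt) (injOn_sqMap a) g
  have hpt : ∀ q ∈ s, ENNReal.ofReal (q.1 ^ 2) *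
      ENNReal.ofReal ((Real.sqrt (((a - q.1) ^ 2 + q.2 ^ 2) * ((a + q.1) ^ 2 + q.2 ^ 2)))⁻¹ - t) ≤
      ENNReal.ofReal (1 / 4) * (ENNReal.ofReal |(LinearMap.toContinuousLinearMap
        (Matrix.toLin (Module.Basis.finTwoProd ℝ) (Module.Basis.finTwoProd ℝ)
          !![2 * q.1, -2 * q.2; 2 * q.2, 2 * q.1])).det| * g (f q)) := by
    intro q _
    rw [det_sqMap, abs_of_nonneg (by positivity), ← mul_assoc,
      ← ENNReal.ofReal_mul (show (0 : ℝ) ≤ 1 / 4 by norm_num),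
      show 1 / 4 * (4 * (q.1 ^ 2 + q.2 ^ 2)) = q.1 ^ 2 + q.2 ^ 2 by ring]
    have hD : Real.sqrt (((a - q.1) ^ 2 + q.2 ^ 2) * ((a + q.1) ^ 2 + q.2 ^ 2)) =
        Real.sqrt ((f q).1 ^ 2 + (f q).2 ^ 2) := by
      rw [orbitProduct_eq_sq_add_sq]
    rw [hD]
    exact mul_le_mul' (ENNReal.ofReal_le_ofReal (by nlinarith [sq_nonneg q.2])) le_rfl
  calc ∫⁻ q in s, ENNReal.ofReal (q.1 ^ 2) *
        ENNReal.ofReal ((Real.sqrt (((a - q.1) ^ 2 + q.2 ^ 2) * ((a + q.1) ^ 2 + q.2 ^ 2)))⁻¹ - t)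
      ≤ ∫⁻ q in s, ENNReal.ofReal (1 / 4) * (ENNReal.ofReal |(LinearMap.toContinuousLinearMap
        (Matrix.toLin (Module.Basis.finTwoProd ℝ) (Module.Basis.finTwoProd ℝ)
          !![2 * q.1, -2 * q.2; 2 * q.2, 2 * q.1])).det| * g (f q)) := setLIntegral_mono' hs hpt
    _ = ENNReal.ofReal (1 / 4) * ∫⁻ p in f '' s, g p := by
        rw [lintegral_const_mul' _ _ ENNReal.ofReal_ne_top, hcov]
    _ ≤ ENNReal.ofReal (1 / 4) * ∫⁻ p, g p :=
        mul_le_mul' le_rfl (setLIntegral_le_lintegral _ _)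
    _ = ENNReal.ofReal (1 / 4) * ENNReal.ofReal (π / t) := by
        rw [hgdef, lintegral_ofReal_inv_norm_sub t ht]
    _ = ENNReal.ofReal (π / (4 * t)) := by
        rw [← ENNReal.ofReal_mul (by norm_num)]
        congr 1
        field_simp

end Planar

/-! ### §4 Cylindrical coordinates: the key three-dimensional integral -/

section Reduction

/-- **Radial integration in the plane** (polar coordinates): for measurable `f ≥ 0`,
`∫_{ℝ²} f(|q|) dq = 2π ∫₀^∞ r f(r) dr`. [folklore] -/
private theorem lintegral_comp_sqrt_sq_add_sq {f : ℝ → ℝ≥0∞} (hf : Measurable f) :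
    ∫⁻ q : ℝ × ℝ, f (Real.sqrt (q.1 ^ 2 + q.2 ^ 2)) =
      (∫⁻ r in Ioi (0 : ℝ), ENNReal.ofReal r * f r) * ENNReal.ofReal (2 * π) := by
  rw [← lintegral_comp_polarCoord_symm, polarCoord_target]
  have hcongr : ∀ p ∈ Ioi (0 : ℝ) ×ˢ Ioo (-π) π,
      ENNReal.ofReal p.1 • f (Real.sqrt ((polarCoord.symm p).1 ^ 2 + (polarCoord.symm p).2 ^ 2)) =
        ENNReal.ofReal p.1 * f p.1 := by
    rintro ⟨r, θ⟩ ⟨hr, -⟩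
    have hr : 0 < r := hr
    have hsq : Real.sqrt ((polarCoord.symm (r, θ)).1 ^ 2 + (polarCoord.symm (r, θ)).2 ^ 2) = r := by
      rw [polarCoord_symm_apply]
      simp only
      rw [show (r * Real.cos θ) ^ 2 + (r * Real.sin θ) ^ 2 = r ^ 2 by
        linear_combination r ^ 2 * Real.cos_sq_add_sin_sq θ, Real.sqrt_sq hr.le]
    rw [hsq, smul_eq_mul]
  have hmeas : Measurable fun p : ℝ × ℝ => ENNReal.ofReal p.1 * f p.1 :=
    (measurable_fst.ennreal_ofReal).mul (hf.comp measurable_fst)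
  rw [setLIntegral_congr_fun (measurableSet_Ioi.prod measurableSet_Ioo) hcongr,
    Measure.volume_eq_prod, ← Measure.prod_restrict, lintegral_prod _ hmeas.aemeasurable]
  simp only [lintegral_const, Measure.restrict_apply MeasurableSet.univ, univ_inter,
    Real.volume_Ioo]
  rw [lintegral_mul_const' _ _ ENNReal.ofReal_ne_top]
  congr 2
  ring

/-- **Cylindrical coordinates** for nonnegative functions of `(r(y), y₂)` on `ℝ³`:
`∫_{ℝ³} Φ(r(y), y₂) dy = 2π ∫ dz ∫₀^∞ r Φ(r, z) dr` (the measurable equivalence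
`y ↦ (y₂, (y₀, y₁))` of `cylSplit` followed by polar coordinates in the horizontal plane;
Tonelli, no integrability needed). [folklore] -/
private theorem lintegral_comp_cylRadius_eq {Φ : ℝ × ℝ → ℝ≥0∞} (hΦ : Measurable Φ) :
    ∫⁻ y : EuclideanSpace ℝ (Fin 3), Φ (cylRadius y, y 2) =
      (∫⁻ z : ℝ, ∫⁻ r in Ioi (0 : ℝ), ENNReal.ofReal r * Φ (r, z)) * ENNReal.ofReal (2 * π) := by
  set e : EuclideanSpace ℝ (Fin 3) ≃ᵐ ℝ × (ℝ × ℝ) := cylSplit.trans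
    (MeasurableEquiv.prodCongr (MeasurableEquiv.refl ℝ)
      ((MeasurableEquiv.toLp 2 (Fin 2 → ℝ)).symm.trans MeasurableEquiv.finTwoArrow)) with he
  have hmp : MeasurePreserving e volume volume :=
    measurePreserving_cylSplit.trans ((MeasurePreserving.id volume).prod
      ((EuclideanSpace.volume_preserving_symm_measurableEquiv_toLp (Fin 2)).trans
        (volume_preserving_finTwoArrow ℝ)))
  have hcomp : ∀ y : EuclideanSpace ℝ (Fin 3), Φ (cylRadius y, y 2) =
      (fun p : ℝ × (ℝ × ℝ) => Φ (Real.sqrt (p.2.1 ^ 2 + p.2.2 ^ 2), p.1)) (e y) := by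
    intro y; rfl
  have hm3 : Measurable fun p : ℝ × (ℝ × ℝ) => Φ (Real.sqrt (p.2.1 ^ 2 + p.2.2 ^ 2), p.1) := by
    refine hΦ.comp ?_
    fun_prop
  calc ∫⁻ y, Φ (cylRadius y, y 2)
      = ∫⁻ y, (fun p : ℝ × (ℝ × ℝ) => Φ (Real.sqrt (p.2.1 ^ 2 + p.2.2 ^ 2), p.1)) (e y) :=
        lintegral_congr hcomp
    _ = ∫⁻ p : ℝ × (ℝ × ℝ), Φ (Real.sqrt (p.2.1 ^ 2 + p.2.2 ^ 2), p.1) :=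
        hmp.lintegral_comp_emb e.measurableEmbedding
          (fun p : ℝ × (ℝ × ℝ) => Φ (Real.sqrt (p.2.1 ^ 2 + p.2.2 ^ 2), p.1))
    _ = ∫⁻ z : ℝ, ∫⁻ q : ℝ × ℝ, Φ (Real.sqrt (q.1 ^ 2 + q.2 ^ 2), z) := by
        rw [Measure.volume_eq_prod]
        exact lintegral_prod _ hm3.aemeasurable
    _ = ∫⁻ z : ℝ, (∫⁻ r in Ioi (0 : ℝ), ENNReal.ofReal r * Φ (r, z)) * ENNReal.ofReal (2 * π) :=
        lintegral_congr fun z =>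
          lintegral_comp_sqrt_sq_add_sq (f := fun r => Φ (r, z)) (hΦ.comp measurable_prodMk_right)
    _ = (∫⁻ z : ℝ, ∫⁻ r in Ioi (0 : ℝ), ENNReal.ofReal r * Φ (r, z)) * ENNReal.ofReal (2 * π) :=
        lintegral_mul_const' _ _ ENNReal.ofReal_ne_top

/-- **THE KEY THREE-DIMENSIONAL INTEGRAL**: for every `x ∈ ℝ³` and `t > 0`,
`∫_{ℝ³} r(y) ((d₁d₂)⁻¹ − t)₊ dy ≤ π²/(2t)`, where `d₁ d₂ = d₁(x,y) d₂(x,y)` is the product of the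
distances, in the meridian half-plane, from `(r(y), y₂)` to `(r(x), x₂)` and to `(−r(x), x₂)`
(cylindrical coordinates reduce it to `2π ×` the planar estimate
`lintegral_halfPlane_sq_mul_orbitKernel_sub_le`; equality in the limit `r(x) → ∞`). [folklore] -/
private theorem lintegral_cylRadius_mul_orbitKernel_sub_le (x : EuclideanSpace ℝ (Fin 3)) {t : ℝ}
    (ht : 0 < t) :
    ∫⁻ y, ENNReal.ofReal (cylRadius y) * ENNReal.ofReal ((Real.sqrt (((cylRadius x -
        cylRadius y) ^ 2 + (x 2 - y 2) ^ 2) * ((cylRadius x + cylRadius y) ^ 2 +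
          (x 2 - y 2) ^ 2)))⁻¹ - t) ≤ ENNReal.ofReal (π ^ 2 / (2 * t)) := by
  set a : ℝ := cylRadius x with hadef
  set c : ℝ := x 2 with hcdef
  -- the integrand as a function of `(r(y), y₂)`
  set Φ : ℝ × ℝ → ℝ≥0∞ := fun p => ENNReal.ofReal p.1 * ENNReal.ofReal ((Real.sqrt (((a - p.1) ^ 2 +
    (p.2 - c) ^ 2) * ((a + p.1) ^ 2 + (p.2 - c) ^ 2)))⁻¹ - t) with hΦdef
  have hΦm : Measurable Φ := by
    rw [hΦdef]
    refine (measurable_fst.ennreal_ofReal).mul (Measurable.ennreal_ofReal ?_)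
    refine Measurable.sub_const (Measurable.inv ?_) _
    fun_prop
  have hcomp : ∀ y : EuclideanSpace ℝ (Fin 3), ENNReal.ofReal (cylRadius y) *
      ENNReal.ofReal ((Real.sqrt (((a - cylRadius y) ^ 2 + (c - y 2) ^ 2) *
        ((a + cylRadius y) ^ 2 + (c - y 2) ^ 2)))⁻¹ - t) = Φ (cylRadius y, y 2) := by
    intro y
    simp only [hΦdef]
    rw [show (c - y 2) ^ 2 = (y 2 - c) ^ 2 by ring]
  rw [lintegral_congr hcomp, lintegral_comp_cylRadius_eq hΦm]
  -- swap the order of integration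
  have hK : Measurable fun p : ℝ × ℝ => ENNReal.ofReal p.2 * Φ (p.2, p.1) :=
    (measurable_snd.ennreal_ofReal).mul (hΦm.comp (measurable_snd.prodMk measurable_fst))
  have hswap : ∫⁻ z : ℝ, ∫⁻ r in Ioi (0 : ℝ), ENNReal.ofReal r * Φ (r, z) =
      ∫⁻ r in Ioi (0 : ℝ), ∫⁻ z : ℝ, ENNReal.ofReal r * Φ (r, z) :=
    lintegral_lintegral_swap (hK.aemeasurable (μ := volume.prod (volume.restrict (Ioi 0))))
  rw [hswap]
  -- translate `z ↦ z + x₂` and collect `r · r = r²`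
  set Ψ : ℝ × ℝ → ℝ≥0∞ := fun q => ENNReal.ofReal (q.1 ^ 2) *
    ENNReal.ofReal ((Real.sqrt (((a - q.1) ^ 2 + q.2 ^ 2) * ((a + q.1) ^ 2 + q.2 ^ 2)))⁻¹ - t)
    with hΨdef
  have hΨm : Measurable Ψ := by
    rw [hΨdef]
    refine ((measurable_fst.pow_const 2).ennreal_ofReal).mul (Measurable.ennreal_ofReal ?_)
    refine Measurable.sub_const (Measurable.inv ?_) _
    fun_prop
  have hinner : ∀ r ∈ Ioi (0 : ℝ), ∫⁻ z : ℝ, ENNReal.ofReal r * Φ (r, z) = ∫⁻ h : ℝ, Ψ (r, h) := by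
    intro r hr
    have hr : 0 < r := hr
    rw [← lintegral_sub_right_eq_self (fun h : ℝ => Ψ (r, h)) c]
    refine lintegral_congr fun z => ?_
    simp only [hΦdef, hΨdef]
    rw [← mul_assoc, ← ENNReal.ofReal_mul hr.le, ← sq]
  rw [setLIntegral_congr_fun measurableSet_Ioi hinner]
  -- the iterated integral is the integral over the half-plane
  have hprod : ∫⁻ r in Ioi (0 : ℝ), ∫⁻ h : ℝ, Ψ (r, h) =
      ∫⁻ q in Ioi (0 : ℝ) ×ˢ (univ : Set ℝ), Ψ q := by
    rw [Measure.volume_eq_prod, ← Measure.prod_restrict, lintegral_prod _ hΨm.aemeasurable,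
      Measure.restrict_univ]
  rw [hprod]
  calc (∫⁻ q in Ioi (0 : ℝ) ×ˢ (univ : Set ℝ), Ψ q) * ENNReal.ofReal (2 * π)
      ≤ ENNReal.ofReal (π / (4 * t)) * ENNReal.ofReal (2 * π) :=
        mul_le_mul' (lintegral_halfPlane_sq_mul_orbitKernel_sub_le a ht) le_rfl
    _ = ENNReal.ofReal (π ^ 2 / (2 * t)) := by
        rw [← ENNReal.ofReal_mul (by positivity)]
        congr 1
        field_simp
        ring

end Reduction

/-! ### §5 Assembly: duality and the constant `1/(2√2)` -/

section Assembly

variable {w : EuclideanSpace ℝ (Fin 3) → EuclideanSpace ℝ (Fin 3)} {M : ℝ}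

/-- Pointwise duality (the bathtub principle, linearised): for `‖v‖ ≤ m` and `t ≥ 0`,
`‖v‖ D⁻¹ ≤ t ‖v‖ + m (D⁻¹ − t)₊` (in `ℝ≥0∞`, `ofReal` truncating at `0`). [folklore] -/
private theorem enorm_mul_ofReal_inv_le (v : EuclideanSpace ℝ (Fin 3)) {m D t : ℝ}
    (hvm : ‖v‖ ≤ m) (ht : 0 ≤ t) :
    ‖v‖ₑ * ENNReal.ofReal D⁻¹ ≤
      ENNReal.ofReal t * ‖v‖ₑ + ENNReal.ofReal m * ENNReal.ofReal (D⁻¹ - t) := by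
  by_cases h : D⁻¹ ≤ t
  · calc ‖v‖ₑ * ENNReal.ofReal D⁻¹ ≤ ‖v‖ₑ * ENNReal.ofReal t :=
          mul_le_mul' le_rfl (ENNReal.ofReal_le_ofReal h)
      _ = ENNReal.ofReal t * ‖v‖ₑ := mul_comm _ _
      _ ≤ ENNReal.ofReal t * ‖v‖ₑ + ENNReal.ofReal m * ENNReal.ofReal (D⁻¹ - t) := le_self_add
  · have h' : t < D⁻¹ := not_le.1 h
    have hv0 : 0 ≤ ‖v‖ := norm_nonneg v
    have hm0 : 0 ≤ m := hv0.trans hvm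
    rw [← ofReal_norm, ← ENNReal.ofReal_mul hv0, ← ENNReal.ofReal_mul ht,
      ← ENNReal.ofReal_mul hm0,
      show ‖v‖ * D⁻¹ = t * ‖v‖ + ‖v‖ * (D⁻¹ - t) by ring,
      ENNReal.ofReal_add (by positivity) (mul_nonneg hv0 (by linarith))]
    gcongr

/-- **Duality for the orbit-averaged majorant**: for any measurable `D`, any `t ≥ 0` and
`‖w(y)‖ ≤ M r(y)`, `∫ ‖w‖ D⁻¹ ≤ t ∫‖w‖ + M ∫ r(y) (D⁻¹ − t)₊ dy`. [folklore] -/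
private theorem lintegral_enorm_mul_inv_le_duality {D : EuclideanSpace ℝ (Fin 3) → ℝ} (hD : Measurable D)
    (hwc : Continuous w) (hwM : ∀ y, ‖w y‖ ≤ M * cylRadius y) (hM : 0 ≤ M) {t : ℝ}
    (ht : 0 ≤ t) :
    ∫⁻ y, ‖w y‖ₑ * ENNReal.ofReal (D y)⁻¹ ≤
      (ENNReal.ofReal t * ∫⁻ y, ‖w y‖ₑ) +
        ENNReal.ofReal M * ∫⁻ y, ENNReal.ofReal (cylRadius y) * ENNReal.ofReal ((D y)⁻¹ - t) := by
  have hwm : Measurable fun y => ‖w y‖ₑ := hwc.measurable.enorm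
  have hm2 : Measurable fun y : EuclideanSpace ℝ (Fin 3) =>
      ENNReal.ofReal (cylRadius y) * ENNReal.ofReal ((D y)⁻¹ - t) :=
    (continuous_cylRadius.measurable.ennreal_ofReal).mul ((hD.inv.sub_const t).ennreal_ofReal)
  calc ∫⁻ y, ‖w y‖ₑ * ENNReal.ofReal (D y)⁻¹
      ≤ ∫⁻ y, (ENNReal.ofReal t * ‖w y‖ₑ +
          ENNReal.ofReal M * (ENNReal.ofReal (cylRadius y) * ENNReal.ofReal ((D y)⁻¹ - t))) := by
        refine lintegral_mono fun y => ?_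
        have h := enorm_mul_ofReal_inv_le (w y) (D := D y) (hwM y) ht
        rwa [ENNReal.ofReal_mul hM, mul_assoc] at h
    _ = (ENNReal.ofReal t * ∫⁻ y, ‖w y‖ₑ) +
        ENNReal.ofReal M * ∫⁻ y, ENNReal.ofReal (cylRadius y) * ENNReal.ofReal ((D y)⁻¹ - t) := by
        rw [lintegral_add_left (hwm.const_mul _), lintegral_const_mul _ hwm,
          lintegral_const_mul _ hm2]

/-- **THE AXISYMMETRIC BIOT–SAVART SUP BOUND WITH THE CONSTANT `1/(2√2)`** (Feng–Šverák /
Gallay–Šverák (2.14), three-dimensional form, sharpened constant): for a continuous integrable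
vector field `w` on `ℝ³` whose norm is invariant under the rotations about the axis
(`‖w(R_θ y)‖ = ‖w(y)‖`; every axisymmetric field) with `‖w(y)‖ ≤ M r(y)`, the Biot–Savart velocity
obeys `‖(K₃ ∗ w)(x)‖ ≤ √(M ∫‖w‖ / 8) = (2√2)⁻¹ (M ∫‖w‖)^{1/2}` for every `x`. In the units of
Gallay–Šverák (`∫_{ℝ³}‖ω‖ = 2π‖rω_θ‖_{L¹(Ω)}`, `M = ‖ω_θ/r‖_{L^∞}`):
`‖u‖_{L^∞} ≤ (π/4)^{1/2} ‖rω_θ‖_{L¹(Ω)}^{1/2} ‖ω_θ/r‖_{L^∞}^{1/2}`. The constant is the exact value of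
the bathtub (linear-programming) bound for the isotropic majorant `(4π)⁻¹|x−y|⁻²` of the kernel
over `{|ω| ≤ M r, ∫|ω| = A}` (attained in the limit of thin rings far from the axis), so it is
within the factor `(2√2)⁻¹/(√3/8) ≈ 1.63` of the sharp constant `√3/8` of the true kernel
(Hill-type extremiser on the axis). Proof: orbit-averaged majorant
(`enorm_biotSavart_le_lintegral_orbitKernel`), duality at threshold `t`
(`lintegral_enorm_mul_inv_le_duality`), the key integral
(`lintegral_cylRadius_mul_orbitKernel_sub_le`): `‖u(x)‖ ≤ tA/(4π) + πM/(8t)`, and the choice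
`t = 2π s/A`, `s = √(AM/8)`. [cite: GallaySverak2016, Prop. 2.6 (2.14) (arXiv p. 8)] -/
theorem norm_biotSavart_le_sqrt_div_eight (hwc : Continuous w) (hwi : Integrable w)
    (hw : ∀ θ y, ‖w (rotZ θ y)‖ = ‖w y‖) (hwM : ∀ y, ‖w y‖ ≤ M * cylRadius y)
    (x : EuclideanSpace ℝ (Fin 3)) :
    ‖biotSavart w x‖ ≤ Real.sqrt ((∫ y, ‖w y‖) * M / 8) := by
  set A : ℝ := ∫ y, ‖w y‖ with hAdef
  have hA0 : 0 ≤ A := integral_nonneg fun _ => norm_nonneg _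
  have hπ := Real.pi_pos
  by_cases hw0 : ∀ y, w y = 0
  · have : w = 0 := funext hw0
    rw [this, biotSavart_zero, Pi.zero_apply, norm_zero]
    positivity
  obtain ⟨y₀, hy₀⟩ := not_forall.1 hw0
  have hMpos : 0 < M := by
    by_contra hle
    have h1 := hwM y₀
    have h2 : 0 < ‖w y₀‖ := norm_pos_iff.2 hy₀
    nlinarith [cylRadius_nonneg y₀, not_lt.1 hle]
  have hApos : 0 < A := by
    rw [hAdef, integral_pos_iff_support_of_nonneg (fun _ => norm_nonneg _) hwi.norm]
    refine (hwc.norm.isOpen_support).measure_pos volume ⟨y₀, ?_⟩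
    rw [mem_support]; exact (norm_pos_iff.2 hy₀).ne'
  set s : ℝ := Real.sqrt (A * M / 8) with hsdef
  have hs : 0 < s := Real.sqrt_pos.2 (by positivity)
  have hs2 : s ^ 2 = A * M / 8 := Real.sq_sqrt (by positivity)
  set t : ℝ := 2 * π * s / A with htdef
  have ht : 0 < t := by positivity
  -- the bound `(4π)⁻¹ (tA + M π²/(2t)) = s`
  have hval : (4 * π)⁻¹ * (t * A + M * (π ^ 2 / (2 * t))) = s := by
    rw [htdef]
    field_simp
    linear_combination (-8 : ℝ) * hs2
  have hAe : ∫⁻ y, ‖w y‖ₑ = ENNReal.ofReal A := (ofReal_integral_norm_eq_lintegral_enorm hwi).symm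
  -- the chain in `ℝ≥0∞`
  have hDm : Measurable fun y : EuclideanSpace ℝ (Fin 3) => Real.sqrt (((cylRadius x -
      cylRadius y) ^ 2 + (x 2 - y 2) ^ 2) * ((cylRadius x + cylRadius y) ^ 2 + (x 2 - y 2) ^ 2)) := by
    have hc : Measurable (cylRadius : EuclideanSpace ℝ (Fin 3) → ℝ) := continuous_cylRadius.measurable
    have h2m : Measurable fun y : EuclideanSpace ℝ (Fin 3) => y 2 :=
      (PiLp.continuous_apply 2 _ 2).measurable
    fun_prop
  have h1 := enorm_biotSavart_le_lintegral_orbitKernel hwc hw x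
  have h2 := lintegral_enorm_mul_inv_le_duality hDm hwc hwM hMpos.le ht.le
  have h3 := lintegral_cylRadius_mul_orbitKernel_sub_le x ht
  have hB0 : 0 ≤ (4 * π)⁻¹ * (t * A + M * (π ^ 2 / (2 * t))) := by positivity
  have h : ‖biotSavart w x‖ₑ ≤ ENNReal.ofReal ((4 * π)⁻¹ * (t * A + M * (π ^ 2 / (2 * t)))) := by
    refine h1.trans ?_
    rw [ENNReal.ofReal_mul (by positivity), ENNReal.ofReal_add (by positivity) (by positivity),
      ENNReal.ofReal_mul ht.le, ENNReal.ofReal_mul hMpos.le, ← hAe]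
    gcongr
    exact h2.trans (add_le_add le_rfl (mul_le_mul' le_rfl h3))
  rw [hval, ← ofReal_norm] at h
  exact (ENNReal.ofReal_le_ofReal_iff hs.le).1 h

/-- The same for an AXISYMMETRIC vector field (`w(R_θ y) = R_θ w(y)`; the norm is then rotation
invariant): `‖(K₃ ∗ w)(x)‖ ≤ √(M ∫‖w‖ / 8)`. [cite: GallaySverak2016, Prop. 2.6 (2.14) (arXiv p. 8)] -/
theorem norm_biotSavart_le_sqrt_div_eight_of_isAxisymmetric (hwc : Continuous w) (hwi : Integrable w)
    (hax : IsAxisymmetric w) (hwM : ∀ y, ‖w y‖ ≤ M * cylRadius y) (x : EuclideanSpace ℝ (Fin 3)) :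
    ‖biotSavart w x‖ ≤ Real.sqrt ((∫ y, ‖w y‖) * M / 8) :=
  norm_biotSavart_le_sqrt_div_eight hwc hwi (fun θ y => by rw [hax θ y, norm_rotZ]) hwM x

/-- Numerical form: `‖(K₃ ∗ w)(x)‖ ≤ 0.35356 √(M ∫‖w‖)` (`1/(2√2) = 0.353553…`), to be compared with
the `C = 3` of `norm_biotSavart_le_sqrt_of_norm_le_mul_cylRadius` and with the sharp `√3/8 = 0.2165…`.
[cite: GallaySverak2016, Prop. 2.6 (2.14) (arXiv p. 8)] -/
theorem norm_biotSavart_le_const_mul_sqrt (hwc : Continuous w) (hwi : Integrable w)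
    (hw : ∀ θ y, ‖w (rotZ θ y)‖ = ‖w y‖) (hwM : ∀ y, ‖w y‖ ≤ M * cylRadius y)
    (x : EuclideanSpace ℝ (Fin 3)) :
    ‖biotSavart w x‖ ≤ 0.35356 * Real.sqrt ((∫ y, ‖w y‖) * M) := by
  have h := norm_biotSavart_le_sqrt_div_eight hwc hwi hw hwM x
  have hA0 : 0 ≤ (∫ y, ‖w y‖) * M := by
    rcases le_or_gt 0 M with hM | hM
    · exact mul_nonneg (integral_nonneg fun _ => norm_nonneg _) hM
    · -- `M < 0` forces `w = 0`
      have hw0 : ∀ y, w y = 0 := fun y => by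
        have := hwM y
        have : ‖w y‖ ≤ 0 := this.trans (mul_nonpos_of_nonpos_of_nonneg hM.le (cylRadius_nonneg y))
        exact norm_le_zero_iff.1 this
      simp [hw0]
  refine h.trans ?_
  rw [show (∫ y, ‖w y‖) * M / 8 = (1 / 8) * ((∫ y, ‖w y‖) * M) by ring,
    Real.sqrt_mul (by norm_num), show Real.sqrt (1 / 8 : ℝ) = Real.sqrt (1 / 8) from rfl]
  gcongr
  rw [Real.sqrt_le_left (by norm_num)]
  norm_num

end Assembly

end Literature.Analysis.FluidPDE

end
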